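import Mathlib

/-!
# Sketch — crux idea `generator-twisted-pairing` (I-3 lens L5) on `stmt-ABC-19678`
(`Summit.ABC.ABC.Theses.IUTThetaPilot.ThetaPartII`, route-ABC-IUTThetaPilot, LINE of record RESHAPE-4).

The one move: DESYNCHRONISE the procession order from the theta labels.  Print ([IUTchI] Prop. 4.11,
«S⋆_j = {1, 2, …, j} ⊆ F_l⋇ relative to †χ») orders the capsule by the loop-adjacency generator `1`, so the
tensor packet of size `j+1` carries the theta value of exponent `j²`.  Ordering the procession by another
unit `a⁻¹ ∈ F_l⋇` instead puts the value of exponent `|a·j|²` (least absolute residue) into the packet of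
size `j+1`; `a = 2⁻¹` (the HALVING twist: even packets `j` carry exponent `j/2`, odd packets carry
`l⋆ − (j−1)/2`) is the bed-optimal universal representative.  Per-place TOTALS are invariant (Gauss-lemma
permutation), so E⋆, the Masser/Szpiro-6 budget and the capacity Π_w are print's; only the PACKING of
demand against the SPEC's within-place netting changes.

Honesty: computed ≠ proved; typed ≠ proved; a law fitted ≠ a theorem; an identification object proposed ≠
IUT repaired; no side is taken on [IUTchIII] Cor. 3.12 (D-0045); NOT abc — the object is capacity-coupled
(H3/H4 honoured), exponent −1 along the height ray like every [0,1]-law of the SPEC.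
-/

set_option linter.dupNamespace false

namespace Summit.ABC.ABC.Cruxes.ThetaPartII.GeneratorTwistedPairing

open Finset

/-- Twisted exponent: procession position `j` carries the theta value of exponent `|a·j|_l`
(`a = 1` is print's pairing). -/
def twistExp (l : ℕ) (a : ZMod l) (j : ℕ) : ℕ := ((a * (j : ZMod l)).valMinAbs).natAbs

/-- The label / packet-position set `{1, …, l⋆}`, `l⋆ = l / 2`. -/
def labels (l : ℕ) : Finset ℕ := Ico 1 (l / 2).succ

/-- TOTALS INVARIANCE: every per-place total that is a function of the exponent alone (print mass
`Σ (s²−1)·m_q`, the `m_q`-part of the margins, …) is the same for the twisted pairing as for print. -/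
def TwistTotalsInvariant (l : ℕ) (a : ZMod l) : Prop :=
  ∀ f : ℕ → ℤ, ∑ j ∈ labels l, f (twistExp l a j) = ∑ j ∈ labels l, f j

/-- First lemma of the line (PROVED here from Mathlib's Gauss-lemma permutation
`ZMod.Ico_map_valMinAbs_natAbs_eq_Ico_map_id`): `j ↦ |a·j|` permutes `{1,…,l⋆}` for `l` prime, `a ≠ 0`. -/
theorem twistTotalsInvariant_of_ne_zero (l : ℕ) [Fact l.Prime] (a : ZMod l) (ha : a ≠ 0) :
    TwistTotalsInvariant l a := by
  intro f
  have h := ZMod.Ico_map_valMinAbs_natAbs_eq_Ico_map_id l a ha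
  have hm : ((labels l).1.map fun j => f (twistExp l a j)) = ((labels l).1.map fun j => f j) := by
    have h' := congrArg (Multiset.map f) h
    simpa [labels, twistExp, Multiset.map_map, Function.comp_def] using h'
  rw [Finset.sum_eq_multiset_sum, Finset.sum_eq_multiset_sum]
  exact congrArg Multiset.sum hm

/-! ## Cell currency of the SPEC (I1-EVO-DUALS-A/B §0, VERBATIM), with the exponent `s` decoupled from the
packet position `j` (variant T1: the different term `j·D` and the radii `(j+1)·R` follow the PACKET). -/

/-- demand of a cell holding exponent `s`: `(s² − 1)·m_q`. -/
def cellDemand (mq : ℤ) (s : ℕ) : ℤ := ((s : ℤ) ^ 2 - 1) * mq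

/-- `x = s²·m_q − j·D − (j+1)·R_in` (exponent `s` in the packet at position `j`). -/
def cellX (mq D Rin : ℤ) (s j : ℕ) : ℤ := (s : ℤ) ^ 2 * mq - (j : ℤ) * D - ((j : ℤ) + 1) * Rin

/-- `margin = m_q − [e·⌊x/e⌋ + (j+1)·R_out]` (`/` on `ℤ` with `e > 0` is floor division). -/
def cellMargin (e mq D Rin Rout : ℤ) (s j : ℕ) : ℤ :=
  mq - (e * (cellX mq D Rin s j / e) + ((j : ℤ) + 1) * Rout)

/-- within-place netting of the kept packets under the pairing `a` (the SPEC's tier D1/L1a). -/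
def placeNetting (e mq D Rin Rout : ℤ) (l : ℕ) (a : ZMod l) (keep : Finset ℕ) : ℤ :=
  ∑ j ∈ keep, cellMargin e mq D Rin Rout (twistExp l a j) j

/-- kept demand of the kept packets under the pairing `a`. -/
def keptDemand (mq : ℤ) (l : ℕ) (a : ZMod l) (keep : Finset ℕ) : ℤ :=
  ∑ j ∈ keep, cellDemand mq (twistExp l a j)

/-- A pairing `a` with kept set `keep` CLOSES the place iff its netting is nonnegative. -/
def ClosesPlace (e mq D Rin Rout : ℤ) (l : ℕ) (a : ZMod l) (keep : Finset ℕ) : Prop :=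
  0 ≤ placeNetting e mq D Rin Rout l a keep

/-! ## Worked budget-bound place (FREY133, p = 7, l = 107: e = 1605, m_q = 210, D = 1604,
R_in = 268, R_out = −4472; print mass M_w = 10 707 060; the SPEC's ceiling there: C3 kept share 0.6798,
capacity bound Π/M = 0.8756).  Certificates by `native_decide` (compiled evaluation of closed integer terms,
axiom `Lean.ofReduceBool`): COMPUTED in Lean, not a kernel proof of anything about IUT. -/

/-- print (a = 1), all 53 packets kept: netting −1 332 482 < 0 (the place is budget-bound). -/
example : placeNetting 1605 210 1604 268 (-4472) 107 1 (labels 107) = -1332482 := by native_decide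

/-- totals invariance instance: the halving twist (a = 2⁻¹ = 54) has the same all-kept netting. -/
example : placeNetting 1605 210 1604 268 (-4472) 107 54 (labels 107) = -1332482 := by native_decide

/-- print must drop its 7 top labels {47,…,53} to close (whole cells): kept demand 7 027 650 / 10 707 060 = 0.656. -/
example : ClosesPlace 1605 210 1604 268 (-4472) 107 1 (Ico 1 47) ∧
    ¬ ClosesPlace 1605 210 1604 268 (-4472) 107 1 (Ico 1 48) ∧
    keptDemand 210 107 1 (Ico 1 47) = 7027650 := by
  unfold ClosesPlace; native_decide

/-- the halving twist closes after dropping only the three odd packets {1,3,5} (exponents 53, 52, 51):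
netting +298 474 ≥ 0, kept demand 9 003 750 / 10 707 060 = 0.841 (> C3's 0.680; capacity bound 0.876). -/
example : ClosesPlace 1605 210 1604 268 (-4472) 107 54 ((labels 107) \ {1, 3, 5}) ∧
    placeNetting 1605 210 1604 268 (-4472) 107 54 ((labels 107) \ {1, 3, 5}) = 298474 ∧
    keptDemand 210 107 54 ((labels 107) \ {1, 3, 5}) = 9003750 := by
  unfold ClosesPlace; native_decide

/-- the halving shape at l = 107: even packets j carry exponent j/2, odd packets carry 53 − (j−1)/2. -/
example : ∀ j ∈ labels 107, twistExp 107 54 j = if j % 2 = 0 then j / 2 else 53 - (j - 1) / 2 := by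
  native_decide

end Summit.ABC.ABC.Cruxes.ThetaPartII.GeneratorTwistedPairing
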